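import Mathlib
import Summits.Ventures.PercRepro2.Defs
import Summits.Ventures.PercRepro2.Independence
import Summits.Ventures.PercRepro2.Harris
import Summits.Ventures.PercRepro2.Graph
import Summits.Ventures.PercRepro2.Exploration
import Summits.Ventures.PercRepro2.FourFunctions
import Summits.Ventures.PercRepro2.Induced
import Summits.Ventures.PercRepro2.Frontier
import Summits.Ventures.PercRepro2.VdBKahn

/-!
# The classical one-vertex family (K1) / (K2) / (BHK-MONO) (blind cell PercRepro2, typer-1;
mine-c g3 MINE-C.md §10.9; lead g11 CONJECTURES v2.99m/v2.99s rows 2′K1 / 2′K2 / 2′BHK-MONO, ASSIGNMENTS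
11:56:28Z "(K1)/(K2) Props"; engine D59 n = 6 FULL 0 / 403,200 steps each)

No edge `e` at all: product measure `p`, root `s`, avoided set `T`, a vertex `v` and the cluster events
`X = {A ⊆ C(s)}`, `Y = {B ⊆ C(s)}`. Masses on `R_T = {s ↮ T}`: `P, F, G, A`; on `E = R_T ∩ {v ∈ C(s)}`:
`p, φ, γ, α`; on `R′ = R_{T ∪ {v}}`: `P′, F′, G′, A′`. `D(T) = P·A − F·G` is the two-copy BHK slack.

* **`K1`**: `A p + P α ≥ F γ + G φ` (`D(T) ≥ D_mix`, i.e. `E[(X − X′)(Y − Y′); v ∈ C′(s)] ≥ 0`);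
* **`K2`**: `α P′ + A′ p ≥ φ G′ + F′ γ` (`D_mix ≥ D(T′)`);
* **`BHKMono`**: `D(T ∪ {v}) ≤ D(T)` — the two-copy slack is non-increasing in the avoided set;
* `bhkMono_iff`: `2 (D(T) − D(T′)) = slack(K1) + slack(K2)` (from `R_T = E ⊔ R′`), so
  `bhkMono_of_K1_of_K2`.
-/

namespace Summit.Ventures.PercRepro2

namespace OneVertex

variable {V : Type*} {E : Type*} [Fintype E] [DecidableEq E] [DecidableEq V]
  {R : Type*} [Field R] [LinearOrder R] [IsStrictOrderedRing R]

section Defs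

variable (p : E → R) (ends : E → Sym2 V) (s : V) (T : Finset V) (v : V) (A B : Finset V)

/-- `E = R_T ∩ {v ∈ C(s)}`. -/
def Ev : Set (Config E) := avoidAll ends s T ∩ connEvent ends s v

/-- **(K1)**: `A·p + P·α ≥ F·γ + G·φ`. -/
def K1 : Prop :=
  prob p (avoidAll ends s T ∩ connAll ends s A) * prob p (Ev ends s T v ∩ connAll ends s B) +
      prob p (avoidAll ends s T ∩ connAll ends s B) * prob p (Ev ends s T v ∩ connAll ends s A) ≤
    prob p (avoidAll ends s T ∩ (connAll ends s A ∩ connAll ends s B)) * prob p (Ev ends s T v) +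
      prob p (avoidAll ends s T) * prob p (Ev ends s T v ∩ (connAll ends s A ∩ connAll ends s B))

/-- **(K2)**: `α·P′ + A′·p ≥ φ·G′ + F′·γ`. -/
def K2 : Prop :=
  prob p (Ev ends s T v ∩ connAll ends s A) * prob p (avoidAll ends s (insert v T) ∩ connAll ends s B) +
      prob p (avoidAll ends s (insert v T) ∩ connAll ends s A) *
        prob p (Ev ends s T v ∩ connAll ends s B) ≤
    prob p (Ev ends s T v ∩ (connAll ends s A ∩ connAll ends s B)) *
        prob p (avoidAll ends s (insert v T)) +
      prob p (avoidAll ends s (insert v T) ∩ (connAll ends s A ∩ connAll ends s B)) *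
        prob p (Ev ends s T v)

/-- The two-copy BHK slack `D(T) = P(R_T) P(R_T ∩ X ∩ Y) − P(R_T ∩ X) P(R_T ∩ Y)`. -/
noncomputable def slack (T : Finset V) : R :=
  prob p (avoidAll ends s T) * prob p (avoidAll ends s T ∩ (connAll ends s A ∩ connAll ends s B)) -
    prob p (avoidAll ends s T ∩ connAll ends s A) * prob p (avoidAll ends s T ∩ connAll ends s B)

/-- **(BHK-MONO)**: `D(T ∪ {v}) ≤ D(T)`. -/
def BHKMono : Prop := slack p ends s A B (insert v T) ≤ slack p ends s A B T

end Defs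

section Closure

variable (R : Type*) [Field R] [LinearOrder R] [IsStrictOrderedRing R]

/-- (K1) over all finite graphs, admissible weights, roots, avoided sets, vertices and targets. -/
def K1_all : Prop :=
  ∀ (V E : Type) [Fintype V] [DecidableEq V] [Fintype E] [DecidableEq E]
    (ends : E → Sym2 V) (p : E → R), IsProbVec p →
    ∀ (s : V) (T : Finset V) (v : V) (A B : Finset V), s ∉ T → v ∉ T → v ≠ s → v ∉ A → v ∉ B →
      K1 p ends s T v A B

/-- (K2) over all finite graphs, admissible weights, roots, avoided sets, vertices and targets. -/
def K2_all : Prop :=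
  ∀ (V E : Type) [Fintype V] [DecidableEq V] [Fintype E] [DecidableEq E]
    (ends : E → Sym2 V) (p : E → R), IsProbVec p →
    ∀ (s : V) (T : Finset V) (v : V) (A B : Finset V), s ∉ T → v ∉ T → v ≠ s → v ∉ A → v ∉ B →
      K2 p ends s T v A B

/-- (BHK-MONO) over all finite graphs, admissible weights, roots, avoided sets, vertices and targets. -/
def BHKMono_all : Prop :=
  ∀ (V E : Type) [Fintype V] [DecidableEq V] [Fintype E] [DecidableEq E]
    (ends : E → Sym2 V) (p : E → R), IsProbVec p →
    ∀ (s : V) (T : Finset V) (v : V) (A B : Finset V), s ∉ T → v ∉ T → v ≠ s → v ∉ A → v ∉ B →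
      BHKMono p ends s T v A B

end Closure

section Decomposition

variable (p : E → R) (ends : E → Sym2 V) (s : V) (T : Finset V) (v : V)

omit [Fintype E] [DecidableEq E] [LinearOrder R] [IsStrictOrderedRing R] in
/-- `R_{T ∪ {v}} = R_T ∖ {v ∈ C(s)}`. -/
lemma avoidAll_insert_eq :
    avoidAll ends s (insert v T) = avoidAll ends s T ∩ (connEvent ends s v)ᶜ := by
  ext ω
  simp only [avoidAll, Set.mem_setOf_eq, Set.mem_inter_iff, Set.mem_compl_iff, connEvent,
    Finset.forall_mem_insert]
  tauto

omit [LinearOrder R] [IsStrictOrderedRing R] in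
/-- Every `R_T`-mass splits along `v ∈ C(s)`: `P(R_T ∩ Z) = P(E ∩ Z) + P(R′ ∩ Z)`. -/
lemma prob_avoidAll_inter_eq (Z : Set (Config E)) :
    prob p (avoidAll ends s T ∩ Z) =
      prob p (Ev ends s T v ∩ Z) + prob p (avoidAll ends s (insert v T) ∩ Z) := by
  rw [avoidAll_insert_eq]
  have hu := prob_union_add_prob_inter p (Ev ends s T v ∩ Z)
    (avoidAll ends s T ∩ (connEvent ends s v)ᶜ ∩ Z)
  have hdisj : Ev ends s T v ∩ Z ∩ (avoidAll ends s T ∩ (connEvent ends s v)ᶜ ∩ Z) = ∅ := by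
    ext ω
    simp only [Ev, Set.mem_inter_iff, Set.mem_compl_iff, Set.mem_empty_iff_false, iff_false]
    tauto
  have hcover : Ev ends s T v ∩ Z ∪ avoidAll ends s T ∩ (connEvent ends s v)ᶜ ∩ Z =
      avoidAll ends s T ∩ Z := by
    ext ω
    simp only [Ev, Set.mem_union, Set.mem_inter_iff, Set.mem_compl_iff]
    tauto
  rw [hdisj, prob_empty, add_zero, hcover] at hu
  exact hu

omit [LinearOrder R] [IsStrictOrderedRing R] in
/-- `P(R_T) = P(E) + P(R′)`. -/
lemma prob_avoidAll_eq :
    prob p (avoidAll ends s T) = prob p (Ev ends s T v) + prob p (avoidAll ends s (insert v T)) := by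
  have := prob_avoidAll_inter_eq p ends s T v Set.univ
  simpa only [Set.inter_univ] using this

omit [LinearOrder R] [IsStrictOrderedRing R] in
/-- **`2 (D(T) − D(T ∪ {v})) = slack(K1) + slack(K2)`**: (BHK-MONO) is the average of (K1) and (K2). -/
theorem two_mul_slack_sub_eq (A B : Finset V) :
    2 * (slack p ends s A B T - slack p ends s A B (insert v T)) =
      (prob p (avoidAll ends s T ∩ (connAll ends s A ∩ connAll ends s B)) * prob p (Ev ends s T v) +
          prob p (avoidAll ends s T) * prob p (Ev ends s T v ∩ (connAll ends s A ∩ connAll ends s B)) -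
        (prob p (avoidAll ends s T ∩ connAll ends s A) * prob p (Ev ends s T v ∩ connAll ends s B) +
          prob p (avoidAll ends s T ∩ connAll ends s B) * prob p (Ev ends s T v ∩ connAll ends s A))) +
      (prob p (Ev ends s T v ∩ (connAll ends s A ∩ connAll ends s B)) *
            prob p (avoidAll ends s (insert v T)) +
          prob p (avoidAll ends s (insert v T) ∩ (connAll ends s A ∩ connAll ends s B)) *
            prob p (Ev ends s T v) -
        (prob p (Ev ends s T v ∩ connAll ends s A) *
            prob p (avoidAll ends s (insert v T) ∩ connAll ends s B) +
          prob p (avoidAll ends s (insert v T) ∩ connAll ends s A) *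
            prob p (Ev ends s T v ∩ connAll ends s B))) := by
  unfold slack
  rw [prob_avoidAll_eq p ends s T v, prob_avoidAll_inter_eq p ends s T v (connAll ends s A),
    prob_avoidAll_inter_eq p ends s T v (connAll ends s B),
    prob_avoidAll_inter_eq p ends s T v (connAll ends s A ∩ connAll ends s B)]
  ring

/-- **(K1) ∧ (K2) ⟹ (BHK-MONO)**. -/
theorem bhkMono_of_K1_of_K2 (A B : Finset V) (h1 : K1 p ends s T v A B) (h2 : K2 p ends s T v A B) :
    BHKMono p ends s T v A B := by
  unfold BHKMono
  have h := two_mul_slack_sub_eq p ends s T v A B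
  unfold K1 at h1
  unfold K2 at h2
  nlinarith [h, h1, h2]

end Decomposition

end OneVertex

end Summit.Ventures.PercRepro2

/-! ## Status (2026-08-23, typer-1 g7; lead ASSIGNMENTS v11.12 typer item (3))

The whole WEIGHTED one-vertex family is REFUTED (conjectures/NEGATIVE.md NEG-71, NEG-72); the
identities of this file stand.

* `K1_all` is FALSE — NEG-71 (lead g11 13:23:44Z; engine D71, three exact implementations, lead
  re-check `recheck18.py`): `c7_00277`, edges (file order) 03 04 13 16 25 26 36 45 46 56, `s = 6`,
  `v = 0`, `a = 1`, `b = 2`, `T = ∅`, `p = (1/32, 1/32, 1/16, 15/16, 1/8, 7/8, 15/16, 1/8, 7/8, 7/8)`: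
  `(K1) = −3708381705 / 2⁷³ ≈ −3.93·10⁻¹³` (at this instance (K2) and (BHK-MONO) are positive).
* `K2_all` and `BHKMono_all` are FALSE — NEG-72 (lead g11 13:25:55Z; engine D73, two independent
  exact derivations, lead re-check `recheck19.py`): `c8_01200` (edges 03 14 17 25 27 34 36 47 56 57
  67), `s = 7`, `v = 0` (the leaf at `3`), `a = 1`, `b = 2`, `T = ∅`, the NEG-71 vector transported
  along `c8_01200 − leaf ≅ c7_00277` plus the leaf weight `q = 1/256` on `03`:
  `(K2) = −357627889815 / 2⁸⁹ ≈ −5.78·10⁻¹⁶`, `D(∅) − D({v}) = −1306973606295 / 2⁹⁰ ≈ −1.06·10⁻¹⁵`.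
  Mechanism (mine-c g5 MINE-C.md §12.6, the two-sided hub criterion; lead re-check `recheck22.py`
  exact): for `G − v = G_A ∪ G_B` glued at `s` with `a ∈ G_A`, `b ∈ G_B` and `v` a hub of weight `t`
  to `z ∈ G_A`, `w ∈ G_B`, `(K1) = t² (B₄ C_A + A₄ C_B − C_A C_B) + O(t³)`, negative for all small `t`
  iff `A₄/C_A + B₄/C_B < 1` (`0.9606` on `c7_00277`; hence the `10⁻¹³` delicacy).

What stands: `avoidAll_insert_eq`, `prob_avoidAll_inter_eq`, `prob_avoidAll_eq`,
`two_mul_slack_sub_eq` (`2 (D(T) − D(T′)) = slack(K1) + slack(K2)`) and the implication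
`bhkMono_of_K1_of_K2`. Fibre-wise: NEG-70 gives negative fibres for (K2)/(BHK-MONO) at `n = 8`
(`c8_01200`: fibre-(K2) `= −1`, fibre-(BHK-MONO) `= −2`), and fibre positivity would imply weighted
positivity (the weighted kernel is `Σ_k P(k) · (fibre sum)`), which is how the weighted witnesses
were found (coordinate-descent climbs on negative fibres).
-/
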